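import Summits.QuantumFields.BalabanUV.T4Continuum.Support.SubstrateBlockAvgContinuity
import HarnessLib

/-!
# `AlphaInputsT3ACv3LocalSmall` — STRATEGY B for 2′, THE SMALL-LOOP CLASS OF THE (0.4) BLOCK AVERAGING **LOCALISED** TO A DEPENDENCY-CLOSED
# FAMILY OF BONDS: closed, and the averages of record `(blockAvg ℰ)^s U (b)` are continuous on it AT THE BONDS OF THE FAMILY — lane `pub-balaban3d`,
# seat alpha-2 (g2)

WHY.  Seat g0's adapted class `AlphaInputsT3AC.adaptedClassT3` (`AlphaInputsT3ACv3AdaptedClass`) is cut by the GLOBAL nested small-loop class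
`SubstrateBlockAvgContinuity.NestedSmall ℰp (δ/2) k` (every (0.4) loop variable of every level `< k` on the whole torus within `δ/2`).  The rows the
v3 socket reads at a non-trivial history — (42)-top on `bondsIn k Ω_k(h)`, (68) multi-level on `plaqsIn s (lam42 … k i)` — only evaluate the averages on
the dependency cones over `Ω_k(h)` ∕ `Λ_i(h)`; outside them (e.g. high averages over an early large-field region `Λ_j(h)`, `j ≪ k`) neither print's
(42)-minimiser nor the tree's regular profiles (`…N08AlphaProfileBuild.prof`) control the loop variables.  This file supplies the LOCALISED class that the
re-cut adapted class (sibling `AlphaInputsT3ACv3AdaptedClassL`) uses instead.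

WHAT (generic torus `P`, gauge group `G`, small-loop average `ℰ`; [Balaban1987RG1] (0.4) p.253 structure only — no estimate):
* §1 `Feeds b c` (the locality relation of `Setup.Averaging.local_dep`: the level-`j` bond `b` issues from `B(c₋) ∪ B(c₊)`), `DepClosed E`, the
  inductive DEPENDENCY HULL `hull R` of a family of read bonds (`subset_hull`, `depClosed_hull`, `hull_minimal`);
* §2 `NestedSmallOn ℰ δ′ E k` := «for `i < k`, at every bond `c ∈ E (i+1)` every (0.4) loop variable of `(blockAvg ℰ)^i U` is within `δ′`»; monotonicity,
  `1 ∈`, and `NestedSmall ℰ δ′ k ⊆ NestedSmallOn ℰ δ′ E k` (the global class is the case `E = univ`);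
* §3 ★ `isClosed_nestedSmallOn`, ★ `continuousOn_iter_eval` (`b ∈ E s`, `s ≤ k`), `continuousOn_loopHol_iter`, `continuousOn_plaqHol_iter` — joint induction on the
  level exactly as `SubstrateBlockAvgContinuity.isClosed_nestedSmall_and_continuousOn_rawIter`, with `Averaging.local_dep` (`loopHol_local`, `axialAvg_local`)
  replacing global continuity: at a bond of the family the next average reads only bonds of the family (dependency-closedness), where the previous averages
  are continuous by induction, and the guard of `blockAvg` is inactive on the class (`δ′ < ℰ.δ`).
HONEST FRAMING.  Kernel topology; no estimate of [B7]∕[7]∕[B10]; count-neutral helper toward R3 2′ (`stub_laneRecordsV3`, items 19935∕19936); nothing here is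
a claim about d = 4, the continuum, or a mass gap.

References: T. Bałaban, Commun. Math. Phys. 109 (1987) 249–301 [Balaban1987RG1] ((0.4) p.253); CMP 98 (1985) 17–51 [Balaban1985Averaging] ((15) p.19, locality).
-/

set_option autoImplicit false

noncomputable section

open scoped Topology

namespace Summit.QuantumFields.YangMills.Theorems.LocalSmallLoop

open Set
open Literature.MathematicalPhysics.QuantumFieldTheory.Balaban1983to89
open Literature.MathematicalPhysics.QuantumFieldTheory.Balaban1983to89.AveragingRT (axialAvg axialAvg_local)
open Literature.MathematicalPhysics.QuantumFieldTheory.Balaban1983to89.BlockAveraging (blockAvg blockAvg_avg avgFun corr Small loopHol Idx loopHol_local)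
open Summit.QuantumFields.BalabanUV.T4Continuum.SubstrateBackground (continuous_eval)
open Summit.QuantumFields.BalabanUV.T4Continuum.SubstrateBackgroundDriven (loopHol_one_cfg blockAvg_one_of_E_one iter_one)
open Summit.QuantumFields.BalabanUV.T4Continuum.SubstrateBlockAvgContinuity (NestedSmall SmallContinuous iter_blockAvg_eq_rawIter continuous_loopHol
  continuous_axialAvg continuous_pathProd)

variable {P : Params} {G : Type*} [GaugeGroup G]

/-! ## §1 The locality relation, dependency-closed families, the dependency hull -/

/-- **THE LOCALITY RELATION OF THE BLOCK AVERAGING** (`Setup.Averaging.local_dep`, [Balaban1985Averaging] p.19): the level-`j` bond `b` issues from one of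
the two blocks `B(c₋)`, `B(c₊)` of the coarse bond `c` — the bonds on which `Ū(c)` depends. [cite: Balaban1985Averaging, (15) p.19] -/
def Feeds {j : ℕ} (b : PBond P j) (c : PBond P (j + 1)) : Prop :=
  blockOf b.src = c.src ∨ blockOf b.src = c.tgt

/-- **A DEPENDENCY-CLOSED FAMILY OF BONDS** `E = (E_i)_i`: every bond feeding a member of `E (i+1)` is a member of `E i`. [folklore] -/
def DepClosed (E : (i : ℕ) → Set (PBond P i)) : Prop :=
  ∀ (i : ℕ) (c : PBond P (i + 1)), c ∈ E (i + 1) → ∀ (b : PBond P i), Feeds b c → b ∈ E i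

/-- The inductive generation of the dependency hull of a family `R` of read bonds: the read bonds, and every bond feeding a member. [folklore] -/
inductive InHull (R : (i : ℕ) → Set (PBond P i)) : (i : ℕ) → PBond P i → Prop
  | base {i : ℕ} {b : PBond P i} (hb : b ∈ R i) : InHull R i b
  | feeds {i : ℕ} {b : PBond P i} {c : PBond P (i + 1)} (hc : InHull R (i + 1) c) (hbc : Feeds b c) : InHull R i b

/-- **THE DEPENDENCY HULL** of a family of read bonds: the least dependency-closed family containing it. [folklore] -/
def hull (R : (i : ℕ) → Set (PBond P i)) : (i : ℕ) → Set (PBond P i) :=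
  fun i => {b | InHull R i b}

/-- The read bonds lie in their hull. [folklore] -/
theorem subset_hull (R : (i : ℕ) → Set (PBond P i)) (i : ℕ) : R i ⊆ hull R i :=
  fun _ hb => InHull.base hb

/-- The hull is dependency-closed. [folklore] -/
theorem depClosed_hull (R : (i : ℕ) → Set (PBond P i)) : DepClosed (hull R) :=
  fun _ _ hc _ hbc => InHull.feeds hc hbc

/-- The hull is the LEAST dependency-closed family containing the read bonds. [folklore] -/
theorem hull_minimal {R E : (i : ℕ) → Set (PBond P i)} (hRE : ∀ i, R i ⊆ E i) (hE : DepClosed E) (i : ℕ) : hull R i ⊆ E i := by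
  intro b hb
  induction hb with
  | base hb => exact hRE _ hb
  | feeds _ hbc ih => exact hE _ _ ih _ hbc

/-- The hull is monotone in the read bonds. [folklore] -/
theorem hull_mono {R R' : (i : ℕ) → Set (PBond P i)} (h : ∀ i, R i ⊆ R' i) (i : ℕ) : hull R i ⊆ hull R' i :=
  hull_minimal (fun i => (h i).trans (subset_hull R' i)) (depClosed_hull R') i

/-- The whole bond set is (trivially) dependency-closed. [folklore] -/
theorem depClosed_univ : DepClosed (fun i => (univ : Set (PBond P i))) :=
  fun _ _ _ _ _ => mem_univ _

/-! ## §2 The localised nested small-loop class -/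

variable (ℰ : LoopAverage G)

/-- **THE NESTED SMALL-LOOP CLASS LOCALISED TO THE FAMILY `E`** with margin `δ′`: for every level `i < k` and every bond `c ∈ E (i+1)`, every (0.4) loop
variable at `c` of the `i`-fold average OF RECORD `(blockAvg ℰ)^i U` is within `δ′` of `1` (a `≤` condition).  For `E = univ` and `δ′ < ℰ.δ` this is
`SubstrateBlockAvgContinuity.NestedSmall` (`nestedSmall_subset_nestedSmallOn`). [cite: Balaban1987RG1, (0.4) p.253] -/
def NestedSmallOn (δ' : ℝ) (E : (i : ℕ) → Set (PBond P i)) (k : ℕ) : Set (GaugeField P 0 G) :=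
  {U | ∀ i, i < k → ∀ c ∈ E (i + 1), ∀ x : Idx P,
    dist1 (loopHol (Averaging.iter (fun j => (blockAvg ℰ : Averaging P j G)) i U) c x) ≤ δ'}

variable {ℰ}

/-- Membership, unfolded. [folklore] -/
theorem mem_nestedSmallOn {δ' : ℝ} {E : (i : ℕ) → Set (PBond P i)} {k : ℕ} {U : GaugeField P 0 G} :
    U ∈ NestedSmallOn ℰ δ' E k ↔ ∀ i, i < k → ∀ c ∈ E (i + 1), ∀ x : Idx P,
      dist1 (loopHol (Averaging.iter (fun j => (blockAvg ℰ : Averaging P j G)) i U) c x) ≤ δ' :=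
  Iff.rfl

/-- Level `0`: no condition. [folklore] -/
@[simp] theorem nestedSmallOn_zero (δ' : ℝ) (E : (i : ℕ) → Set (PBond P i)) : NestedSmallOn ℰ δ' E 0 = (univ : Set (GaugeField P 0 G)) :=
  eq_univ_of_forall fun _ i hi => absurd hi (Nat.not_lt_zero i)

/-- The classes decrease with the level. [folklore] -/
theorem nestedSmallOn_antitone_level {δ' : ℝ} {E : (i : ℕ) → Set (PBond P i)} {k k' : ℕ} (h : k ≤ k') :
    NestedSmallOn ℰ δ' E k' ⊆ (NestedSmallOn ℰ δ' E k : Set (GaugeField P 0 G)) :=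
  fun _ hU i hi => hU i (lt_of_lt_of_le hi h)

/-- The successor class lies in the class. [folklore] -/
theorem nestedSmallOn_succ_subset (δ' : ℝ) (E : (i : ℕ) → Set (PBond P i)) (k : ℕ) :
    NestedSmallOn ℰ δ' E (k + 1) ⊆ (NestedSmallOn ℰ δ' E k : Set (GaugeField P 0 G)) :=
  nestedSmallOn_antitone_level (Nat.le_succ k)

/-- The classes decrease when the family grows. [folklore] -/
theorem nestedSmallOn_antitone_family {δ' : ℝ} {E E' : (i : ℕ) → Set (PBond P i)} (h : ∀ i, E i ⊆ E' i) (k : ℕ) :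
    NestedSmallOn ℰ δ' E' k ⊆ (NestedSmallOn ℰ δ' E k : Set (GaugeField P 0 G)) :=
  fun _ hU i hi c hc x => hU i hi c (h _ hc) x

/-- The successor class is the class cut by the level-`k` conditions at the bonds of `E (k+1)`. [folklore] -/
theorem nestedSmallOn_succ_eq (δ' : ℝ) (E : (i : ℕ) → Set (PBond P i)) (k : ℕ) :
    NestedSmallOn ℰ δ' E (k + 1) =
      NestedSmallOn ℰ δ' E k ∩ {U : GaugeField P 0 G | ∀ c ∈ E (k + 1), ∀ x : Idx P,
        dist1 (loopHol (Averaging.iter (fun j => (blockAvg ℰ : Averaging P j G)) k U) c x) ≤ δ'} := by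
  ext U
  simp only [mem_nestedSmallOn, mem_inter_iff, mem_setOf_eq]
  constructor
  · exact fun h => ⟨fun i hi => h i (Nat.lt_succ_of_lt hi), h k (Nat.lt_succ_self k)⟩
  · rintro ⟨h, hk⟩ i hi
    rcases Nat.lt_succ_iff_lt_or_eq.1 hi with hi' | rfl
    · exact h i hi'
    · exact hk

/-- **THE GLOBAL CLASS LIES IN EVERY LOCALISED CLASS** (margin `δ′ < ℰ.δ`: on the global class the averaging of record is the unguarded iterate,
`iter_blockAvg_eq_rawIter`, whose loop variables the global class bounds everywhere). [cite: Balaban1987RG1, (0.4) p.253] -/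
theorem nestedSmall_subset_nestedSmallOn {δ' : ℝ} (hδ : δ' < ℰ.δ) (E : (i : ℕ) → Set (PBond P i)) (k : ℕ) :
    NestedSmall (P := P) ℰ δ' k ⊆ NestedSmallOn ℰ δ' E k := by
  intro U hU i hi c _ x
  have hUi : U ∈ NestedSmall (P := P) ℰ δ' i := by
    intro i' hi' c' x'
    exact hU i' (lt_trans hi' hi) c' x'
  rw [iter_blockAvg_eq_rawIter ℰ hδ i U hUi]
  exact hU i hi c x

/-- **THE TRIVIAL CONFIGURATION IS IN EVERY LOCALISED CLASS** (`0 ≤ δ′`, `ℰ` normalised at identity families). [folklore] -/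
theorem one_mem_nestedSmallOn (hE : ∀ m : ℕ, ℰ.E (fun _ : Fin (m + 1) => (1 : G)) = 1) {δ' : ℝ} (hδ' : 0 ≤ δ')
    (E : (i : ℕ) → Set (PBond P i)) (k : ℕ) : (1 : GaugeField P 0 G) ∈ NestedSmallOn ℰ δ' E k := by
  intro i _ c _ x
  rw [iter_one (fun j => (blockAvg ℰ : Averaging P j G)) (fun _ => blockAvg_one_of_E_one ℰ hE) i, loopHol_one_cfg, GaugeGroup.dist1_one]
  exact hδ'

/-! ## §3 Closedness, and continuity of the averages of record at the bonds of the family -/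

section Continuity

variable [TopologicalSpace G] [IsTopologicalGroup G]

open Classical in
/-- **LOCALITY ⇒ LOCAL CONTINUITY OF THE LOOP VARIABLES**: if the bond variables of `V x` feeding the coarse bond `c` are continuous on `A`, so is every
(0.4) loop variable of `V x` at `c` (patch the other bonds by `1`: `loopHol_local`). [cite: Balaban1985Averaging, (15) p.19] -/
theorem continuousOn_loopHol_of_feeds {X : Type*} [TopologicalSpace X] {j : ℕ} (hj : j + 1 ≤ P.m + P.K) {V : X → GaugeField P j G}
    {A : Set X} (c : PBond P (j + 1)) (hV : ∀ b : PBond P j, Feeds b c → ContinuousOn (fun x => V x b) A) (i : Idx P) :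
    ContinuousOn (fun x => loopHol (V x) c i) A := by
  let W : X → GaugeField P j G := fun x b => if Feeds b c then V x b else 1
  have hW : ContinuousOn W A := by
    refine continuousOn_pi.2 fun b => ?_
    by_cases hb : Feeds b c
    · simp only [W, if_pos hb]; exact hV b hb
    · simp only [W, if_neg hb]; exact continuousOn_const
  have heq : (fun x => loopHol (V x) c i) = fun x => loopHol (W x) c i := by
    funext x
    exact congrFun (loopHol_local hj (V x) (W x) c fun b hb => by simp only [W, Feeds, if_pos hb]) i
  rw [heq]
  exact (continuous_loopHol c i).comp_continuousOn hW

open Classical in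
/-- **LOCALITY ⇒ LOCAL CONTINUITY OF THE STRAIGHT-LINE TRANSPORTER** at `c` (`axialAvg_local`). [cite: Balaban1985Averaging, (15) p.19] -/
theorem continuousOn_axialAvg_of_feeds {X : Type*} [TopologicalSpace X] {j : ℕ} (hj : j + 1 ≤ P.m + P.K) {V : X → GaugeField P j G}
    {A : Set X} (c : PBond P (j + 1)) (hV : ∀ b : PBond P j, Feeds b c → ContinuousOn (fun x => V x b) A) :
    ContinuousOn (fun x => axialAvg (V x) c) A := by
  let W : X → GaugeField P j G := fun x b => if Feeds b c then V x b else 1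
  have hW : ContinuousOn W A := by
    refine continuousOn_pi.2 fun b => ?_
    by_cases hb : Feeds b c
    · simp only [W, if_pos hb]; exact hV b hb
    · simp only [W, if_neg hb]; exact continuousOn_const
  have heq : (fun x => axialAvg (V x) c) = fun x => axialAvg (W x) c := by
    funext x
    exact axialAvg_local hj (V x) (W x) c fun b hb => by simp only [W, Feeds, if_pos hb]
  rw [heq]
  exact ((continuous_apply c).comp continuous_axialAvg).comp_continuousOn hW

/-- **★ THE LOCALISED CLASS IS CLOSED AND THE AVERAGES OF RECORD ARE CONTINUOUS ON IT AT THE BONDS OF THE FAMILY** (joint induction on the level,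
`SubstrateBlockAvgContinuity.isClosed_nestedSmall_and_continuousOn_rawIter` localised by `Averaging.local_dep`): for a dependency-closed family `E`,
a margin `δ′ < ℰ.δ`, continuous `dist1` and a small-loop average continuous on small families, and `k` in the standing range. [cite: Balaban1987RG1, (0.4) p.253] -/
theorem isClosed_nestedSmallOn_and_continuousOn (hd : Continuous (dist1 : G → ℝ)) (hE' : SmallContinuous ℰ) {δ' : ℝ} (hδ : δ' < ℰ.δ)
    {E : (i : ℕ) → Set (PBond P i)} (hE : DepClosed E) :
    ∀ k, k ≤ P.m + P.K → IsClosed (NestedSmallOn ℰ δ' E k) ∧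
      ∀ b ∈ E k, ContinuousOn (fun U : GaugeField P 0 G => Averaging.iter (fun j => (blockAvg ℰ : Averaging P j G)) k U b) (NestedSmallOn ℰ δ' E k)
  | 0, _ => by
    rw [nestedSmallOn_zero]
    exact ⟨isClosed_univ, fun b _ => (continuous_eval b).continuousOn⟩
  | k + 1, hk => by
    obtain ⟨hcl, hco⟩ := isClosed_nestedSmallOn_and_continuousOn hd hE' hδ hE k (Nat.le_of_succ_le hk)
    -- local continuity of the level-`k` loop variables and transporters at the bonds of `E (k+1)`, on the level-`k` class
    have hloop : ∀ c ∈ E (k + 1), ∀ x : Idx P, ContinuousOn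
        (fun U : GaugeField P 0 G => loopHol (Averaging.iter (fun j => (blockAvg ℰ : Averaging P j G)) k U) c x) (NestedSmallOn ℰ δ' E k) :=
      fun c hc x => continuousOn_loopHol_of_feeds hk c (fun b hb => hco b (hE k c hc b hb)) x
    have hax : ∀ c ∈ E (k + 1), ContinuousOn
        (fun U : GaugeField P 0 G => axialAvg (Averaging.iter (fun j => (blockAvg ℰ : Averaging P j G)) k U) c) (NestedSmallOn ℰ δ' E k) :=
      fun c hc => continuousOn_axialAvg_of_feeds hk c fun b hb => hco b (hE k c hc b hb)
    refine ⟨?_, fun c hc => ?_⟩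
    · rw [nestedSmallOn_succ_eq]
      have hset : NestedSmallOn ℰ δ' E k ∩ {U : GaugeField P 0 G | ∀ c ∈ E (k + 1), ∀ x : Idx P,
          dist1 (loopHol (Averaging.iter (fun j => (blockAvg ℰ : Averaging P j G)) k U) c x) ≤ δ'} =
          NestedSmallOn ℰ δ' E k ∩ ⋂ c : PBond P (k + 1), ⋂ (_ : c ∈ E (k + 1)), ⋂ x : Idx P, (NestedSmallOn ℰ δ' E k ∩
            (fun U => dist1 (loopHol (Averaging.iter (fun j => (blockAvg ℰ : Averaging P j G)) k U) c x)) ⁻¹' Iic δ') := by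
        ext U
        simp only [mem_inter_iff, mem_setOf_eq, mem_iInter, mem_preimage, mem_Iic]
        exact ⟨fun h => ⟨h.1, fun c hc x => ⟨h.1, h.2 c hc x⟩⟩, fun h => ⟨h.1, fun c hc x => (h.2 c hc x).2⟩⟩
      rw [hset]
      exact hcl.inter (isClosed_iInter fun c => isClosed_iInter fun hc => isClosed_iInter fun x =>
        ((hd.comp_continuousOn (hloop c hc x)).preimage_isClosed_of_isClosed hcl isClosed_Iic))
    · -- on the level-`(k+1)` class the guard is inactive at `c`: the average of record is `ℰ.avg (loops) · (transporter)`
      have hsub := nestedSmallOn_succ_subset (ℰ := ℰ) δ' E k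
      have hfam : ContinuousOn (fun U : GaugeField P 0 G =>
          (loopHol (Averaging.iter (fun j => (blockAvg ℰ : Averaging P j G)) k U) c ∘ ⇑(LoopAverage.enum (Idx P)).symm : Fin _ → G))
          (NestedSmallOn ℰ δ' E (k + 1)) :=
        continuousOn_pi.2 fun i => (hloop c hc _).mono hsub
      have hmaps : MapsTo (fun U : GaugeField P 0 G =>
          (loopHol (Averaging.iter (fun j => (blockAvg ℰ : Averaging P j G)) k U) c ∘ ⇑(LoopAverage.enum (Idx P)).symm : Fin _ → G))
          (NestedSmallOn ℰ δ' E (k + 1)) {W | ∀ i, dist1 (W i) < ℰ.δ} :=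
        fun U hU i => (hU k (Nat.lt_succ_self k) c hc _).trans_lt hδ
      have hΦ : ContinuousOn (fun U : GaugeField P 0 G =>
          ℰ.E (loopHol (Averaging.iter (fun j => (blockAvg ℰ : Averaging P j G)) k U) c ∘ ⇑(LoopAverage.enum (Idx P)).symm) *
            axialAvg (Averaging.iter (fun j => (blockAvg ℰ : Averaging P j G)) k U) c) (NestedSmallOn ℰ δ' E (k + 1)) :=
        ((hE' _).comp hfam hmaps).mul ((hax c hc).mono hsub)
      refine hΦ.congr fun U hU => ?_
      have hsm : Small ℰ (Averaging.iter (fun j => (blockAvg ℰ : Averaging P j G)) k U) c :=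
        fun x => (hU k (Nat.lt_succ_self k) c hc x).trans_lt hδ
      show (blockAvg ℰ).avg (Averaging.iter (fun j => (blockAvg ℰ : Averaging P j G)) k U) c = _
      rw [blockAvg_avg]
      show corr ℰ _ c * axialAvg _ c = _
      rw [corr, if_pos hsm]
      rfl

/-- **★ THE LOCALISED NESTED SMALL-LOOP CLASS IS CLOSED.** [cite: Balaban1987RG1, (0.4) p.253] -/
theorem isClosed_nestedSmallOn (hd : Continuous (dist1 : G → ℝ)) (hE' : SmallContinuous ℰ) {δ' : ℝ} (hδ : δ' < ℰ.δ)
    {E : (i : ℕ) → Set (PBond P i)} (hE : DepClosed E) {k : ℕ} (hk : k ≤ P.m + P.K) : IsClosed (NestedSmallOn ℰ δ' E k) :=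
  (isClosed_nestedSmallOn_and_continuousOn hd hE' hδ hE k hk).1

/-- **★ ON THE LOCALISED CLASS THE `s`-FOLD AVERAGE OF RECORD IS CONTINUOUS AT EVERY BOND OF `E s`**, `s ≤ k`. [cite: Balaban1987RG1, (0.4) p.253] -/
theorem continuousOn_iter_eval (hd : Continuous (dist1 : G → ℝ)) (hE' : SmallContinuous ℰ) {δ' : ℝ} (hδ : δ' < ℰ.δ)
    {E : (i : ℕ) → Set (PBond P i)} (hE : DepClosed E) {k : ℕ} (hk : k ≤ P.m + P.K) {s : ℕ} (hs : s ≤ k) {b : PBond P s} (hb : b ∈ E s) :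
    ContinuousOn (fun U : GaugeField P 0 G => Averaging.iter (fun j => (blockAvg ℰ : Averaging P j G)) s U b) (NestedSmallOn ℰ δ' E k) :=
  ((isClosed_nestedSmallOn_and_continuousOn hd hE' hδ hE s (hs.trans hk)).2 b hb).mono (nestedSmallOn_antitone_level hs)

/-- On the localised class the (0.4) loop variables of the `s`-fold average, `s < k`, at a bond of `E (s+1)` are continuous. [cite: Balaban1987RG1, (0.4) p.253] -/
theorem continuousOn_loopHol_iter (hd : Continuous (dist1 : G → ℝ)) (hE' : SmallContinuous ℰ) {δ' : ℝ} (hδ : δ' < ℰ.δ)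
    {E : (i : ℕ) → Set (PBond P i)} (hE : DepClosed E) {k : ℕ} (hk : k ≤ P.m + P.K) {s : ℕ} (hs : s < k) {c : PBond P (s + 1)}
    (hc : c ∈ E (s + 1)) (x : Idx P) :
    ContinuousOn (fun U : GaugeField P 0 G => loopHol (Averaging.iter (fun j => (blockAvg ℰ : Averaging P j G)) s U) c x)
      (NestedSmallOn ℰ δ' E k) :=
  continuousOn_loopHol_of_feeds (Nat.succ_le_of_lt (lt_of_lt_of_le hs hk)) c
    (fun b hb => continuousOn_iter_eval hd hE' hδ hE hk hs.le (hE s c hc b hb)) x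

/-- On the localised class the plaquette variable of the `s`-fold average at a plaquette whose four bonds lie in `E s` is continuous, `s ≤ k`.
[cite: Balaban1987RG1, (0.4) p.253] -/
theorem continuousOn_plaqHol_iter (hd : Continuous (dist1 : G → ℝ)) (hE' : SmallContinuous ℰ) {δ' : ℝ} (hδ : δ' < ℰ.δ)
    {E : (i : ℕ) → Set (PBond P i)} (hE : DepClosed E) {k : ℕ} (hk : k ≤ P.m + P.K) {s : ℕ} (hs : s ≤ k) (q : Plaq P s)
    (h₁ : (⟨q.src, q.μ⟩ : PBond P s) ∈ E s) (h₂ : (⟨q.src.shift q.μ, q.ν⟩ : PBond P s) ∈ E s)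
    (h₃ : (⟨q.src.shift q.ν, q.μ⟩ : PBond P s) ∈ E s) (h₄ : (⟨q.src, q.ν⟩ : PBond P s) ∈ E s) :
    ContinuousOn (fun U : GaugeField P 0 G => GaugeField.plaqHol (Averaging.iter (fun j => (blockAvg ℰ : Averaging P j G)) s U) q)
      (NestedSmallOn ℰ δ' E k) := by
  unfold GaugeField.plaqHol
  exact (((continuousOn_iter_eval hd hE' hδ hE hk hs h₁).mul (continuousOn_iter_eval hd hE' hδ hE hk hs h₂)).mul
    (continuousOn_iter_eval hd hE' hδ hE hk hs h₃).inv).mul (continuousOn_iter_eval hd hE' hδ hE hk hs h₄).inv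

/-- A condition `dist1 (plaqHol ((blockAvg ℰ)^s U) q) ≤ t` at a plaquette read inside the family is closed relative to the localised class. [cite: Balaban1987RG1, (0.4) p.253] -/
theorem isClosed_nestedSmallOn_inter_plaqLe (hd : Continuous (dist1 : G → ℝ)) (hE' : SmallContinuous ℰ) {δ' : ℝ} (hδ : δ' < ℰ.δ)
    {E : (i : ℕ) → Set (PBond P i)} (hE : DepClosed E) {k : ℕ} (hk : k ≤ P.m + P.K) {s : ℕ} (hs : s ≤ k) (q : Plaq P s)
    (h₁ : (⟨q.src, q.μ⟩ : PBond P s) ∈ E s) (h₂ : (⟨q.src.shift q.μ, q.ν⟩ : PBond P s) ∈ E s)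
    (h₃ : (⟨q.src.shift q.ν, q.μ⟩ : PBond P s) ∈ E s) (h₄ : (⟨q.src, q.ν⟩ : PBond P s) ∈ E s) (t : ℝ) :
    IsClosed (NestedSmallOn ℰ δ' E k ∩ {U : GaugeField P 0 G |
      dist1 (GaugeField.plaqHol (Averaging.iter (fun j => (blockAvg ℰ : Averaging P j G)) s U) q) ≤ t}) :=
  (hd.comp_continuousOn (continuousOn_plaqHol_iter hd hE' hδ hE hk hs q h₁ h₂ h₃ h₄)).preimage_isClosed_of_isClosed
    (isClosed_nestedSmallOn hd hE' hδ hE hk) isClosed_Iic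

/-- A condition `(blockAvg ℰ)^s U (b) = w` at a bond of the family is closed relative to the localised class (`G` Hausdorff). [cite: Balaban1987RG1, (0.4) p.253] -/
theorem isClosed_nestedSmallOn_inter_eq [T2Space G] (hd : Continuous (dist1 : G → ℝ)) (hE' : SmallContinuous ℰ) {δ' : ℝ} (hδ : δ' < ℰ.δ)
    {E : (i : ℕ) → Set (PBond P i)} (hE : DepClosed E) {k : ℕ} (hk : k ≤ P.m + P.K) {s : ℕ} (hs : s ≤ k) {b : PBond P s} (hb : b ∈ E s)
    (w : G) :
    IsClosed (NestedSmallOn ℰ δ' E k ∩ {U : GaugeField P 0 G | Averaging.iter (fun j => (blockAvg ℰ : Averaging P j G)) s U b = w}) :=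
  (continuousOn_iter_eval hd hE' hδ hE hk hs hb).preimage_isClosed_of_isClosed (isClosed_nestedSmallOn hd hE' hδ hE hk) (isClosed_singleton (x := w))

end Continuity

end Summit.QuantumFields.YangMills.Theorems.LocalSmallLoop

end
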